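import Mathlib
import Literature.Barriers.PneNP.ExtendedFormulationMinkowskiFaces
import Literature.Barriers.PneNP.ExtendedFormulationLinearImage
import Literature.Barriers.PneNP.CorrelationPolytopeXCLowerBoundGraph
import Summits.ValiantsHypothesis.ValiantsHypothesis.Theorems.FifoMatchingXcDivisionZmixFace
import Summits.ValiantsHypothesis.ValiantsHypothesis.Theorems.FifoMatchingXcDivisionChamberCertificate

/-!
# The SWITCHED-FACE RUNGS — kernel proofs (val-idea-38 g1, WAVE-5 seat W5-P2, crux stmt-ValiantsHypothesis-21181)

FOUR members of the located-point class `SwitchExposed` of the card `Ideas/switched-face-psd-free.md`, all proved here with standard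
axioms, each closing VERBATIM the statement of the same name in `Cruxes/NNDivisionHard/SwitchFace.lean` @763f18c9adde:
* `towerSwitchRung_holds : TowerSwitchRung` (§1–§4) — every 0-1 rank-one tower `Σ_{P b}[−1,1]λ_b bbᵀ` (`Z_full`, `Z_s`, truncations);
* `switchedFaceRung_holds : SwitchedFaceRung` (§5–§6) — the general certificate: `SwitchExposed n q →
  HasEFOfSize (COR(K_{n+1}) + conv q) r → HasEFOfSize (COR(K_n)) r`, via the engine `located_point_rung` (any index type);
* `corMinusCorRung_holds : CorMinusCorRung` (§6) — the difference body `COR(K_{n+1}) − COR(K_{n+1})`;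
* `psdZonotopeRung_holds : PSDZonotopeRung` (§7) — every zonotope with `±`PSD (Gram) generators, any zone count, via
  positivity-preserving genericity `exists_generic_comb_pos` + PSD-freeness `gram_eq_zero_of_psi` + the zonotope vertex lemma `zvtx_unique`.
* §9 the (half-)MOVE-STABLE form (P-P2c): `hasEF_cor_of_selfSimilar` (`COR + (λ·COR + v)` is as hard as `COR`, λ ≥ 0) and
  `switchLocated_selfSimilar_rung` (read fibre = `λ·COR(K_n) + v` ⇒ as hard as `COR(K_n)` — the form surviving the COR-absorbing nf move).
* §8 the TOLERANT engine `located_face_read` (fibre of ANY size: the passenger is replaced by the deletion read of its `C`-fibre —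
  composable with PROP A / class D downstream) and `switchExposedFibre_three_pow_le : 3 ^ n ≤ Nat.card(fibre generators)·(r+1)·2^n`.
Corollaries `*_three_pow_le : 3 ^ n ≤ (r + 1) * 2 ^ n` (Kaibel–Weltge rate, UNBUDGETED, no KMR / Razborov / BFPS).

`towerSwitchRung_holds : TowerSwitchRung` — for EVERY 0-1 rank-one tower `Z = Σ_{P b} [−1,1]·λ_b·bbᵀ` (any sub-family `P`, any real
weights `λ`: `Z_full`, `Z_{h/2}`, `Z_s`, every truncation) an extended formulation of `COR(K_{n+1}) + Z` of size `r` yields one of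
`COR(K_n)` of size `r`; hence (`tower_three_pow_le`) `3^n ≤ (r+1)·2^n` — Kaibel–Weltge rate, UNBUDGETED, no KMR / Razborov / BFPS.
Mechanism (card `Cruxes/NNDivisionHard/Ideas/switched-face-psd-free.md`): the switching functional `C^{(a)}` (`C·x = x_aa + Σ_{p≠a}
(x_ap + x_pa − 2x_pp)`) is `1` on the vertices `bbᵀ` with `b_a = 1`, `−2|b|` on the others: valid, tight exactly on the switched
coordinate face `F_a ≅ COR(K_n)`, and NONZERO on every generator `bbᵀ ≠ 0`, so the `C`-face of the tower is ONE vertex and the `C`-face of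
the sum is `F_a + pt`; translate, read through the deletion map `x ↦ (x_{ιp,ιq})` (`ι = a.succAbove`), done.
Tree tools: `HasEFOfSize.face_add_face₁`, `.image_add_const`, `.image_linearMap` (Literature), `convexHull_range_inter_eq`,
`dot_le_of_mem_convexHull`, `corVec_top_apply` (✓ Theorems.FifoMatchingXcDivisionZmixFace).
HONEST LABEL: helper theorem for an OPEN crux (21181 OPEN; COR-VIRTUAL OPEN); VP ≠ VNP is NOT proved.
-/

set_option autoImplicit false
set_option linter.dupNamespace false

noncomputable section

open Matrix Finset
open scoped Pointwise

namespace Summit.ValiantsHypothesis.ValiantsHypothesis.Cruxes.NNDivisionHard.SwitchFace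

open Literature.Barriers.PneNP (HasEFOfSize)
open Literature.Combinatorics.Optimization (corPolytopeGraph corVec)
open Summit.ValiantsHypothesis.ValiantsHypothesis.Theorems.FifoMatching.XcDivision
  (dot_le_of_mem_convexHull convexHull_range_inter_eq corVec_top_apply corPolytopeGraph_top_add_hull_three_pow_le)

variable {n : ℕ}

/-- a 0/1 rank-one TOWER `Σ_{b : P b} [−1,1] · λ_b · b bᵀ` (same text as `PairFace.tower` / `SwitchFace.tower`). -/
def tower (h : ℕ) (P : (Fin h → Bool) → Prop) [DecidablePred P] (lam : (Fin h → Bool) → ℝ) :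
    Set (Fin h × Fin h → ℝ) :=
  convexHull ℝ (Set.range fun ε : (Fin h → Bool) → Bool =>
    ∑ b : Fin h → Bool, if P b then ((if ε b then (1 : ℝ) else -1) * lam b) • corVec ⊤ b else 0)

/-- ★★ the TOWER RUNG (statement identical to `SwitchFace.TowerSwitchRung` of the sketch). -/
def TowerSwitchRung : Prop :=
  ∀ (n : ℕ) (P : (Fin (n + 1) → Bool) → Prop) [DecidablePred P] (lam : (Fin (n + 1) → Bool) → ℝ) (r : ℕ),
    HasEFOfSize (corPolytopeGraph (⊤ : SimpleGraph (Fin (n + 1))) + tower (n + 1) P lam) r →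
      HasEFOfSize (corPolytopeGraph (⊤ : SimpleGraph (Fin n))) r

/-! ## §1 The switching functional `C^{(a)}`, through its dot products -/

theorem exists_switchFun (a : Fin n) :
    ∃ C : Fin n × Fin n → ℝ, ∀ x : Fin n × Fin n → ℝ,
      C ⬝ᵥ x = x (a, a) + ∑ p : Fin n, if p ≠ a then x (a, p) + x (p, a) - 2 * x (p, p) else 0 := by
  classical
  refine ⟨Pi.single (a, a) 1 + ∑ p : Fin n,
    if p ≠ a then (Pi.single (a, p) 1 + Pi.single (p, a) 1 - (2 : ℝ) • Pi.single (p, p) 1 :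
      Fin n × Fin n → ℝ) else 0, fun x => ?_⟩
  rw [add_dotProduct, sum_dotProduct, single_dotProduct, one_mul]
  congr 1
  refine Finset.sum_congr rfl fun p _ => ?_
  split_ifs
  · rw [sub_dotProduct, add_dotProduct, smul_dotProduct, single_dotProduct, single_dotProduct, single_dotProduct,
      smul_eq_mul]
    ring
  · exact zero_dotProduct x

/-- the all-false vertex is the origin. -/
theorem corVec_eq_zero_of_forall {b : Fin n → Bool} (hb : ∀ p, b p = false) :
    corVec (⊤ : SimpleGraph (Fin n)) b = 0 := by
  funext pq
  obtain ⟨p, q⟩ := pq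
  rw [corVec_top_apply]
  simp [hb p]

section SwitchFun

variable (a : Fin n) {C : Fin n × Fin n → ℝ}
  (hC : ∀ x : Fin n × Fin n → ℝ,
    C ⬝ᵥ x = x (a, a) + ∑ p : Fin n, if p ≠ a then x (a, p) + x (p, a) - 2 * x (p, p) else 0)
include hC

/-- S1 — value on the vertices: `1` if `b_a = 1`, `−2·|b|` otherwise. -/
theorem switch_dot_corVec (b : Fin n → Bool) :
    C ⬝ᵥ corVec (⊤ : SimpleGraph (Fin n)) b =
      if b a = true then 1 else ∑ p : Fin n, if p ≠ a then (if b p = true then (-2 : ℝ) else 0) else 0 := by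
  rw [hC]
  cases hba : b a with
  | false =>
    rw [if_neg Bool.false_ne_true]
    have h1 : corVec (⊤ : SimpleGraph (Fin n)) b (a, a) = 0 := by
      rw [corVec_top_apply]; simp [hba]
    rw [h1, zero_add]
    refine Finset.sum_congr rfl fun p _ => ?_
    split_ifs with hp hbp
    · rw [corVec_top_apply, corVec_top_apply, corVec_top_apply]
      simp [hba, hbp]
    · rw [corVec_top_apply, corVec_top_apply, corVec_top_apply]
      simp [hba, hbp]
    · rfl
  | true =>
    rw [if_pos rfl]
    have h1 : corVec (⊤ : SimpleGraph (Fin n)) b (a, a) = 1 := by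
      rw [corVec_top_apply]; simp [hba]
    have h2 : ∑ p : Fin n, (if p ≠ a then corVec (⊤ : SimpleGraph (Fin n)) b (a, p) +
        corVec (⊤ : SimpleGraph (Fin n)) b (p, a) - 2 * corVec (⊤ : SimpleGraph (Fin n)) b (p, p) else 0) = 0 := by
      refine Finset.sum_eq_zero fun p _ => ?_
      split_ifs with hp
      · rw [corVec_top_apply, corVec_top_apply, corVec_top_apply]
        cases b p <;> norm_num [hba]
      · rfl
    rw [h1, h2, add_zero]

/-- S2a — validity. -/
theorem switch_dot_corVec_le (b : Fin n → Bool) : C ⬝ᵥ corVec (⊤ : SimpleGraph (Fin n)) b ≤ 1 := by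
  rw [switch_dot_corVec a hC]
  split_ifs
  · exact le_rfl
  · calc ∑ p : Fin n, (if p ≠ a then (if b p = true then (-2 : ℝ) else 0) else 0) ≤ 0 :=
          Finset.sum_nonpos fun p _ => by split_ifs <;> norm_num
      _ ≤ 1 := zero_le_one

/-- S2b — tight exactly on the switched coordinate face `{b_a = 1}`. -/
theorem switch_dot_corVec_eq_one_iff (b : Fin n → Bool) :
    C ⬝ᵥ corVec (⊤ : SimpleGraph (Fin n)) b = 1 ↔ b a = true := by
  rw [switch_dot_corVec a hC]
  constructor
  · intro h
    by_contra hba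
    rw [if_neg hba] at h
    have : ∑ p : Fin n, (if p ≠ a then (if b p = true then (-2 : ℝ) else 0) else 0) ≤ 0 :=
      Finset.sum_nonpos fun p _ => by split_ifs <;> norm_num
    linarith
  · intro hba
    rw [if_pos hba]

/-- S2c — NONZERO on every nonzero generator `bbᵀ`. -/
theorem switch_dot_corVec_ne_zero (b : Fin n → Bool) (hb : ∃ p, b p = true) :
    C ⬝ᵥ corVec (⊤ : SimpleGraph (Fin n)) b ≠ 0 := by
  rw [switch_dot_corVec a hC]
  split_ifs with hba
  · exact one_ne_zero
  · obtain ⟨p₀, hp₀⟩ := hb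
    have hp₀a : p₀ ≠ a := by
      rintro rfl
      exact hba hp₀
    have hle : ∑ p : Fin n, (if p ≠ a then (if b p = true then (-2 : ℝ) else 0) else 0) ≤
        (if p₀ ≠ a then (if b p₀ = true then (-2 : ℝ) else 0) else 0) := by
      have key := Finset.single_le_sum
        (f := fun p : Fin n => -(if p ≠ a then (if b p = true then (-2 : ℝ) else 0) else 0))
        (fun p _ => by split_ifs <;> norm_num) (Finset.mem_univ p₀)
      simp only [Finset.sum_neg_distrib] at key
      linarith
    rw [if_pos hp₀a, if_pos hp₀] at hle
    have hlt : ∑ p : Fin n, (if p ≠ a then (if b p = true then (-2 : ℝ) else 0) else 0) < 0 := by linarith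
    exact hlt.ne

/-- validity on the polytope. -/
theorem switch_valid : ∀ x ∈ corPolytopeGraph (⊤ : SimpleGraph (Fin n)), C ⬝ᵥ x ≤ 1 :=
  dot_le_of_mem_convexHull _ _ _ (by rintro _ ⟨b, rfl⟩; exact switch_dot_corVec_le a hC b)

/-- S3a — the `C`-face of `COR(K_n)` is the hull of the vertices with `b_a = 1`. -/
theorem cor_face_eq :
    corPolytopeGraph (⊤ : SimpleGraph (Fin n)) ∩ {x | C ⬝ᵥ x = 1} =
      convexHull ℝ (Set.range fun b : {b : Fin n → Bool // C ⬝ᵥ corVec (⊤ : SimpleGraph (Fin n)) b = 1} =>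
        corVec (⊤ : SimpleGraph (Fin n)) b.1) := by
  unfold corPolytopeGraph
  exact convexHull_range_inter_eq _ C 1 (switch_dot_corVec_le a hC)

/-! ## §2 The `C`-face of a tower is ONE vertex -/

section Tower

variable (P : (Fin n → Bool) → Prop) [DecidablePred P] (lam : (Fin n → Bool) → ℝ)

/-- the sign vertices of the tower. -/
def vtx (ε : (Fin n → Bool) → Bool) : Fin n × Fin n → ℝ :=
  ∑ b : Fin n → Bool, if P b then ((if ε b then (1 : ℝ) else -1) * lam b) • corVec ⊤ b else 0

/-- the maximising sign pattern for `C`. -/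
def sgn : (Fin n → Bool) → Bool := fun b => decide (0 ≤ lam b * (C ⬝ᵥ corVec (⊤ : SimpleGraph (Fin n)) b))

/-- the support value `h_Z(C) = Σ_{P b} |λ_b · C·bbᵀ|`. -/
def hZ : ℝ := ∑ b : Fin n → Bool, if P b then |lam b * (C ⬝ᵥ corVec (⊤ : SimpleGraph (Fin n)) b)| else 0

omit hC in
theorem dot_vtx (ε : (Fin n → Bool) → Bool) :
    C ⬝ᵥ vtx P lam ε =
      ∑ b : Fin n → Bool, if P b then (if ε b then (1 : ℝ) else -1) * (lam b * (C ⬝ᵥ corVec ⊤ b)) else 0 := by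
  unfold vtx
  rw [dotProduct_sum]
  refine Finset.sum_congr rfl fun b _ => ?_
  by_cases hP : P b
  · rw [if_pos hP, if_pos hP, dotProduct_smul, smul_eq_mul]
    ring
  · rw [if_neg hP, if_neg hP]
    exact dotProduct_zero C

omit hC in
theorem sign_mul_le (e : Bool) (t : ℝ) : (if e = true then (1 : ℝ) else -1) * t ≤ |t| := by
  cases e
  · simp [neg_le_abs]
  · simp [le_abs_self]

omit hC in
theorem dsign_mul (t : ℝ) : (if decide (0 ≤ t) = true then (1 : ℝ) else -1) * t = |t| := by
  by_cases h : 0 ≤ t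
  · simp [h, abs_of_nonneg h]
  · simp [h, abs_of_neg (lt_of_not_ge h)]

omit hC in
theorem dot_vtx_le (ε : (Fin n → Bool) → Bool) : C ⬝ᵥ vtx P lam ε ≤ hZ (C := C) P lam := by
  rw [dot_vtx]
  unfold hZ
  exact Finset.sum_le_sum fun b _ => by
    by_cases hP : P b
    · rw [if_pos hP, if_pos hP]
      exact sign_mul_le _ _
    · rw [if_neg hP, if_neg hP]

omit hC in
theorem dot_vtx_sgn : C ⬝ᵥ vtx P lam (sgn (C := C) lam) = hZ (C := C) P lam := by
  rw [dot_vtx]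
  unfold hZ
  refine Finset.sum_congr rfl fun b _ => ?_
  by_cases hP : P b
  · rw [if_pos hP, if_pos hP]
    exact dsign_mul _
  · rw [if_neg hP, if_neg hP]

/-- every tight sign vertex IS the `sgn` vertex (uses S2c: `C·bbᵀ ≠ 0` for `b ≠ 0`). -/
theorem vtx_eq_of_tight (ε : (Fin n → Bool) → Bool) (ht : C ⬝ᵥ vtx P lam ε = hZ (C := C) P lam) :
    vtx P lam ε = vtx P lam (sgn (C := C) lam) := by
  have hterm := (Finset.sum_eq_sum_iff_of_le (s := (Finset.univ : Finset (Fin n → Bool)))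
      (f := fun b => if P b then (if ε b then (1 : ℝ) else -1) * (lam b * (C ⬝ᵥ corVec ⊤ b)) else 0)
      (g := fun b => if P b then |lam b * (C ⬝ᵥ corVec (⊤ : SimpleGraph (Fin n)) b)| else 0)
      (fun b _ => by
        by_cases hP : P b
        · simp only [if_pos hP]
          exact sign_mul_le _ _
        · simp only [if_neg hP]
          exact le_rfl)).1 (by rw [dot_vtx] at ht; exact ht)
  unfold vtx
  refine Finset.sum_congr rfl fun b _ => ?_
  by_cases hP : P b
  · rw [if_pos hP, if_pos hP]
    have hb := hterm b (Finset.mem_univ _)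
    simp only [if_pos hP] at hb
    by_cases hw : lam b * (C ⬝ᵥ corVec (⊤ : SimpleGraph (Fin n)) b) = 0
    · rcases mul_eq_zero.1 hw with hl | hc
      · simp [hl]
      · have hb0 : ∀ p, b p = false := by
          intro p
          by_contra hp
          exact switch_dot_corVec_ne_zero a hC b ⟨p, by simpa using hp⟩ hc
        rw [corVec_eq_zero_of_forall hb0, smul_zero, smul_zero]
    · have hs := dsign_mul (lam b * (C ⬝ᵥ corVec (⊤ : SimpleGraph (Fin n)) b))
      have key : (if ε b = true then (1 : ℝ) else -1) =
          (if sgn (C := C) lam b = true then (1 : ℝ) else -1) := by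
        unfold sgn
        exact mul_right_cancel₀ hw (hb.trans hs.symm)
      rw [key]
  · rw [if_neg hP, if_neg hP]

omit hC in
/-- validity of `C ≤ h_Z(C)` on the tower. -/
theorem tower_valid : ∀ y ∈ tower n P lam, C ⬝ᵥ y ≤ hZ (C := C) P lam :=
  dot_le_of_mem_convexHull _ _ _ (by rintro _ ⟨ε, rfl⟩; exact dot_vtx_le P lam ε)

/-- ★ the `C`-face of the tower is the single vertex `vtx sgn`. -/
theorem tower_face : tower n P lam ∩ {y | C ⬝ᵥ y = hZ (C := C) P lam} = {vtx P lam (sgn (C := C) lam)} := by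
  show convexHull ℝ (Set.range (vtx P lam)) ∩ {y | C ⬝ᵥ y = hZ (C := C) P lam} = _
  rw [convexHull_range_inter_eq (vtx P lam) C _ (dot_vtx_le P lam)]
  have hr : Set.range (fun j : {ε : (Fin n → Bool) → Bool // C ⬝ᵥ vtx P lam ε = hZ (C := C) P lam} =>
      vtx P lam j.1) = {vtx P lam (sgn (C := C) lam)} := by
    ext y
    simp only [Set.mem_range, Set.mem_singleton_iff]
    constructor
    · rintro ⟨⟨ε, hε⟩, rfl⟩
      exact vtx_eq_of_tight a hC P lam ε hε
    · rintro rfl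
      exact ⟨⟨sgn (C := C) lam, dot_vtx_sgn P lam⟩, rfl⟩
  rw [hr, convexHull_singleton]

end Tower

end SwitchFun

/-! ## §3 The deletion read maps the switched face onto `COR(K_n)` -/

/-- the deletion read `x ↦ (x (ι p, ι q))`, `ι = a.succAbove`. -/
def delRead (n : ℕ) (a : Fin (n + 1)) : (Fin (n + 1) × Fin (n + 1) → ℝ) →ₗ[ℝ] (Fin n × Fin n → ℝ) :=
  LinearMap.funLeft ℝ ℝ fun ij : Fin n × Fin n => (a.succAbove ij.1, a.succAbove ij.2)

theorem delRead_corVec (a : Fin (n + 1)) (b : Fin (n + 1) → Bool) :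
    delRead n a (corVec (⊤ : SimpleGraph (Fin (n + 1))) b) = corVec (⊤ : SimpleGraph (Fin n)) (b ∘ a.succAbove) := by
  funext ij
  obtain ⟨i, j⟩ := ij
  rw [delRead, LinearMap.funLeft_apply, corVec_top_apply, corVec_top_apply]
  rfl

theorem delRead_face (a : Fin (n + 1)) {C : Fin (n + 1) × Fin (n + 1) → ℝ} {M : ℝ}
    (tight : ∀ b : Fin (n + 1) → Bool, C ⬝ᵥ corVec (⊤ : SimpleGraph (Fin (n + 1))) b = M ↔ b a = true) :
    delRead n a '' convexHull ℝ (Set.range fun b : {b : Fin (n + 1) → Bool //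
        C ⬝ᵥ corVec (⊤ : SimpleGraph (Fin (n + 1))) b = M} => corVec (⊤ : SimpleGraph (Fin (n + 1))) b.1) =
      corPolytopeGraph (⊤ : SimpleGraph (Fin n)) := by
  unfold corPolytopeGraph
  rw [LinearMap.image_convexHull, ← Set.range_comp]
  congr 1
  ext y
  constructor
  · rintro ⟨⟨b, hb⟩, rfl⟩
    exact ⟨b ∘ a.succAbove, (delRead_corVec a b).symm⟩
  · rintro ⟨e, rfl⟩
    refine ⟨⟨@Fin.insertNth n (fun _ => Bool) a true e,
      (tight _).2 (@Fin.insertNth_apply_same n (fun _ => Bool) a true e)⟩, ?_⟩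
    show delRead n a (corVec ⊤ (@Fin.insertNth n (fun _ => Bool) a true e)) = corVec ⊤ e
    rw [delRead_corVec]
    congr 1
    funext t
    exact @Fin.insertNth_apply_succAbove n (fun _ => Bool) a true e t

/-! ## §4 Assembly -/

/-- ★★ **THE TOWER RUNG HOLDS.** -/
theorem towerSwitchRung_holds : TowerSwitchRung := by
  classical
  intro n P _ lam r h
  obtain ⟨C, hC⟩ := exists_switchFun (n := n + 1) 0
  -- the located face of the sum: `F_0 + {z₀}`
  have h1 := h.face_add_face₁ C 1 (hZ (C := C) P lam) (switch_valid 0 hC) (tower_valid P lam)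
  rw [tower_face 0 hC P lam, Set.add_singleton] at h1
  -- translate back
  have h2 := h1.image_add_const (-vtx P lam (sgn (C := C) lam))
  rw [Set.image_image] at h2
  simp only [add_neg_cancel_right, Set.image_id'] at h2
  -- read the face
  rw [cor_face_eq 0 hC] at h2
  have h3 := h2.image_linearMap (delRead n 0)
  rwa [delRead_face 0 (switch_dot_corVec_eq_one_iff 0 hC)] at h3

/-- COROLLARY: every 0-1 rank-one tower passenger is decided at Kaibel–Weltge rate, unconditionally:
`xc(COR(K_{n+1}) + Z) = r ⇒ 3^n ≤ (r+1)·2^n`. -/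
theorem tower_three_pow_le (n : ℕ) (P : (Fin (n + 1) → Bool) → Prop) [DecidablePred P]
    (lam : (Fin (n + 1) → Bool) → ℝ) (r : ℕ)
    (h : HasEFOfSize (corPolytopeGraph (⊤ : SimpleGraph (Fin (n + 1))) + tower (n + 1) P lam) r) :
    3 ^ n ≤ (r + 1) * 2 ^ n :=
  Literature.Barriers.PneNP.corPolytopeGraph_top_three_pow_le (towerSwitchRung_holds n P lam r h)

/-- `Z_full(K_{n+1}) = Σ_{all b} [−1,1]·bbᵀ` (all generators, unit weights): decided, unconditionally. -/
theorem zFull_three_pow_le (n r : ℕ)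
    (h : HasEFOfSize (corPolytopeGraph (⊤ : SimpleGraph (Fin (n + 1))) +
      tower (n + 1) (fun _ => True) (fun _ => 1)) r) :
    3 ^ n ≤ (r + 1) * 2 ^ n :=
  tower_three_pow_le n _ _ r h

/-! ## §5 The general LOCATED-POINT rung (arbitrary index `a`, arbitrary valid functional tight exactly on `F_a`,
passenger with a unique maximising POINT over any index type) -/

/-- S3a′ — the `C`-face of `COR(K_n)` at any valid level `M` is the hull of the tight vertices. -/
theorem cor_face_eq' {C : Fin n × Fin n → ℝ} {M : ℝ}
    (valid : ∀ b : Fin n → Bool, C ⬝ᵥ corVec (⊤ : SimpleGraph (Fin n)) b ≤ M) :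
    corPolytopeGraph (⊤ : SimpleGraph (Fin n)) ∩ {x | C ⬝ᵥ x = M} =
      convexHull ℝ (Set.range fun b : {b : Fin n → Bool // C ⬝ᵥ corVec (⊤ : SimpleGraph (Fin n)) b = M} =>
        corVec (⊤ : SimpleGraph (Fin n)) b.1) := by
  unfold corPolytopeGraph
  exact convexHull_range_inter_eq _ C M valid

/-- the `C`-face of `conv{q j}` is ONE point when the maximiser is unique AS A POINT (ties only between equal points). -/
theorem hull_face_singleton {m : ℕ} {J : Type} (q : J → (Fin m × Fin m → ℝ)) (C : Fin m × Fin m → ℝ) (j₀ : J)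
    (huniq : ∀ j, C ⬝ᵥ q j < C ⬝ᵥ q j₀ ∨ q j = q j₀) :
    convexHull ℝ (Set.range q) ∩ {y | C ⬝ᵥ y = C ⬝ᵥ q j₀} = {q j₀} := by
  have hle : ∀ j, C ⬝ᵥ q j ≤ C ⬝ᵥ q j₀ := fun j => (huniq j).elim le_of_lt (fun h => by rw [h])
  rw [convexHull_range_inter_eq q C _ hle]
  have hr : (Set.range fun j : {j : J // C ⬝ᵥ q j = C ⬝ᵥ q j₀} => q j.1) = {q j₀} := by
    ext y
    constructor
    · rintro ⟨⟨j, hj⟩, rfl⟩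
      exact (huniq j).elim (fun hlt => absurd hj hlt.ne) id
    · intro hy
      rw [Set.mem_singleton_iff] at hy
      subst hy
      exact ⟨⟨j₀, rfl⟩, rfl⟩
  rw [hr, convexHull_singleton]

/-- ★★ **THE LOCATED-POINT RUNG** (engine behind `SwitchedFaceRung`, `TowerSwitchRung`, `CorMinusCorRung`): a functional `C` valid on
`COR(K_{n+1})` and tight EXACTLY on the switched face `F_a`, with a unique maximising point on the passenger `conv{q j}` (any index type),
transports an EF of `COR(K_{n+1}) + conv{q j}` of size `r` to an EF of `COR(K_n)` of size `r`. -/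
theorem located_point_rung {J : Type} (a : Fin (n + 1)) (C : Fin (n + 1) × Fin (n + 1) → ℝ) (M : ℝ)
    (valid : ∀ b : Fin (n + 1) → Bool, C ⬝ᵥ corVec (⊤ : SimpleGraph (Fin (n + 1))) b ≤ M)
    (tight : ∀ b : Fin (n + 1) → Bool, C ⬝ᵥ corVec (⊤ : SimpleGraph (Fin (n + 1))) b = M ↔ b a = true)
    (q : J → (Fin (n + 1) × Fin (n + 1) → ℝ)) (j₀ : J) (huniq : ∀ j, C ⬝ᵥ q j < C ⬝ᵥ q j₀ ∨ q j = q j₀) (r : ℕ)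
    (h : HasEFOfSize (corPolytopeGraph (⊤ : SimpleGraph (Fin (n + 1))) + convexHull ℝ (Set.range q)) r) :
    HasEFOfSize (corPolytopeGraph (⊤ : SimpleGraph (Fin n))) r := by
  have hle : ∀ j, C ⬝ᵥ q j ≤ C ⬝ᵥ q j₀ := fun j => (huniq j).elim le_of_lt (fun h => by rw [h])
  have hP : ∀ x ∈ corPolytopeGraph (⊤ : SimpleGraph (Fin (n + 1))), C ⬝ᵥ x ≤ M :=
    dot_le_of_mem_convexHull _ _ _ (by rintro _ ⟨b, rfl⟩; exact valid b)
  have hQ : ∀ y ∈ convexHull ℝ (Set.range q), C ⬝ᵥ y ≤ C ⬝ᵥ q j₀ :=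
    dot_le_of_mem_convexHull _ _ _ (by rintro _ ⟨j, rfl⟩; exact hle j)
  -- the located face of the sum: `F_a + {q j₀}`
  have h1 := h.face_add_face₁ C M (C ⬝ᵥ q j₀) hP hQ
  rw [hull_face_singleton q C j₀ huniq, Set.add_singleton] at h1
  -- translate back
  have h2 := h1.image_add_const (-q j₀)
  rw [Set.image_image] at h2
  simp only [add_neg_cancel_right, Set.image_id'] at h2
  -- read the face
  rw [cor_face_eq' valid] at h2
  have h3 := h2.image_linearMap (delRead n a)
  rwa [delRead_face a tight] at h3

/-! ## §6 The class `SwitchExposed` and two more named members: `SwitchedFaceRung`, `CorMinusCorRung` (same text as `SwitchFace.lean`) -/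

/-- ★ CLASS `SwitchExposed` (verbatim `SwitchFace.SwitchExposed`): some index `a` and some functional `C`, valid on `COR(K_{n+1})` and
tight exactly on `F_a`, have a UNIQUE maximising passenger point (ties only between equal points). -/
def SwitchExposed (n : ℕ) {K : ℕ} (q : Fin (K + 1) → (Fin (n + 1) × Fin (n + 1) → ℝ)) : Prop :=
  ∃ (a : Fin (n + 1)) (C : Fin (n + 1) × Fin (n + 1) → ℝ) (M : ℝ),
    (∀ b : Fin (n + 1) → Bool, C ⬝ᵥ corVec ⊤ b ≤ M) ∧ (∀ b : Fin (n + 1) → Bool, C ⬝ᵥ corVec ⊤ b = M ↔ b a = true) ∧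
      ∃ j₀, ∀ j, C ⬝ᵥ q j < C ⬝ᵥ q j₀ ∨ q j = q j₀

/-- ★★ **SWITCHED-FACE RUNG** (verbatim `SwitchFace.SwitchedFaceRung`). -/
def SwitchedFaceRung : Prop :=
  ∀ (n K : ℕ) (q : Fin (K + 1) → (Fin (n + 1) × Fin (n + 1) → ℝ)) (r : ℕ), SwitchExposed n q →
    HasEFOfSize (corPolytopeGraph (⊤ : SimpleGraph (Fin (n + 1))) + convexHull ℝ (Set.range q)) r →
      HasEFOfSize (corPolytopeGraph (⊤ : SimpleGraph (Fin n))) r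

/-- ★★ **THE SWITCHED-FACE RUNG HOLDS.** -/
theorem switchedFaceRung_holds : SwitchedFaceRung := by
  intro n K q r hq h
  obtain ⟨a, C, M, valid, tight, j₀, huniq⟩ := hq
  exact located_point_rung a C M valid tight q j₀ huniq r h

/-- COROLLARY: switch-exposed passengers are decided at Kaibel–Weltge rate `3^n ≤ (r+1)·2^n`. -/
theorem switchExposed_three_pow_le (n K : ℕ) (q : Fin (K + 1) → (Fin (n + 1) × Fin (n + 1) → ℝ)) (r : ℕ)
    (hq : SwitchExposed n q)
    (h : HasEFOfSize (corPolytopeGraph (⊤ : SimpleGraph (Fin (n + 1))) + convexHull ℝ (Set.range q)) r) :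
    3 ^ n ≤ (r + 1) * 2 ^ n :=
  Literature.Barriers.PneNP.corPolytopeGraph_top_three_pow_le (switchedFaceRung_holds n K q r hq h)

/-- ★ **DIFFERENCE BODY** rung (verbatim `SwitchFace.CorMinusCorRung`): `xc(COR(K_{n+1}) − COR(K_{n+1})) ≥ xc(COR(K_n))`. -/
def CorMinusCorRung : Prop :=
  ∀ (n r : ℕ), HasEFOfSize (corPolytopeGraph (⊤ : SimpleGraph (Fin (n + 1))) +
      (-corPolytopeGraph (⊤ : SimpleGraph (Fin (n + 1))))) r →
    HasEFOfSize (corPolytopeGraph (⊤ : SimpleGraph (Fin n))) r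

/-- `−COR` as the hull of the negated vertices. -/
theorem neg_cor_eq (m : ℕ) :
    -corPolytopeGraph (⊤ : SimpleGraph (Fin m)) =
      convexHull ℝ (Set.range fun b : Fin m → Bool => -corVec (⊤ : SimpleGraph (Fin m)) b) := by
  show -convexHull ℝ (Set.range (corVec (⊤ : SimpleGraph (Fin m)))) = _
  rw [← convexHull_neg, Set.neg_range]

/-- ★ **THE DIFFERENCE-BODY RUNG HOLDS**: the switching functional `C^{(0)}` has the UNIQUE minimiser `b = univ ∖ {0}` on `{0,1}^{n+1}`,
so its face on `−COR` is one vertex and `located_point_rung` applies. -/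
theorem corMinusCorRung_holds : CorMinusCorRung := by
  classical
  intro n r h
  obtain ⟨C, hC⟩ := exists_switchFun (n := n + 1) 0
  rw [neg_cor_eq] at h
  let b₀ : Fin (n + 1) → Bool := fun p => decide (p ≠ 0)
  have hb₀a : b₀ 0 = false := by simp [b₀]
  have hb₀p : ∀ p : Fin (n + 1), p ≠ 0 → b₀ p = true := fun p hp => by simp [b₀, hp]
  -- the off-face value `S b = Σ_{p ≠ 0, b p} (−2)` is termwise minimised at `b₀`
  have hterm : ∀ (b : Fin (n + 1) → Bool) (p : Fin (n + 1)),
      (if p ≠ 0 then (if b₀ p = true then (-2 : ℝ) else 0) else 0) ≤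
        (if p ≠ 0 then (if b p = true then (-2 : ℝ) else 0) else 0) := by
    intro b p
    by_cases hp : p ≠ 0
    · rw [if_pos hp, if_pos hp, if_pos (hb₀p p hp)]
      split_ifs <;> norm_num
    · rw [if_neg hp, if_neg hp]
  have hm0 : (∑ p : Fin (n + 1), if p ≠ 0 then (if b₀ p = true then (-2 : ℝ) else 0) else 0) ≤ 0 :=
    Finset.sum_nonpos fun p _ => by split_ifs <;> norm_num
  refine located_point_rung 0 C 1 (switch_dot_corVec_le 0 hC) (switch_dot_corVec_eq_one_iff 0 hC) _ b₀ ?_ r h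
  intro b
  show C ⬝ᵥ (-corVec ⊤ b) < C ⬝ᵥ (-corVec ⊤ b₀) ∨ -corVec ⊤ b = -corVec ⊤ b₀
  rw [dotProduct_neg, dotProduct_neg, switch_dot_corVec 0 hC b, switch_dot_corVec 0 hC b₀,
    if_neg (show ¬ b₀ 0 = true by rw [hb₀a]; exact Bool.false_ne_true)]
  by_cases hba : b 0 = true
  · left
    rw [if_pos hba]
    linarith
  · rw [if_neg hba]
    rcases lt_or_eq_of_le (Finset.sum_le_sum fun p (_ : p ∈ Finset.univ) => hterm b p) with hlt | heq
    · left
      linarith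
    · right
      have hall := (Finset.sum_eq_sum_iff_of_le fun p (_ : p ∈ Finset.univ) => hterm b p).1 heq
      have hbb : b = b₀ := by
        funext p
        by_cases hp : p = 0
        · subst hp
          rw [hb₀a]
          exact Bool.eq_false_iff.mpr hba
        · have hq := hall p (Finset.mem_univ p)
          rw [if_pos hp, if_pos hp, if_pos (hb₀p p hp)] at hq
          by_contra hbp
          rw [if_neg (fun h' => hbp (h'.trans (hb₀p p hp).symm))] at hq
          norm_num at hq
      rw [hbb]

/-- COROLLARY: `xc(COR(K_{n+1}) − COR(K_{n+1})) = r ⇒ 3^n ≤ (r+1)·2^n`. -/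
theorem corMinusCor_three_pow_le (n r : ℕ)
    (h : HasEFOfSize (corPolytopeGraph (⊤ : SimpleGraph (Fin (n + 1))) +
      (-corPolytopeGraph (⊤ : SimpleGraph (Fin (n + 1))))) r) :
    3 ^ n ≤ (r + 1) * 2 ^ n :=
  Literature.Barriers.PneNP.corPolytopeGraph_top_three_pow_le (corMinusCorRung_holds n r h)

/-! ## §7 The PSD-ZONOTOPE rung: a GENERIC direction of the normal cone of `F_0` sees every `±`Gram generator (S4 + S5) -/

/-! ### §7a positivity-preserving genericity (40's `exists_generic_comb`, keeping the signs its own proof produces) -/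

/-- a real `M > K` with `α M + β ≠ 0` for finitely many `(α, β) ≠ 0` (same text as `DimensionRung40.exists_large_avoid`). -/
theorem exists_large_avoid (s : Finset (ℝ × ℝ)) (hs : ∀ p ∈ s, p.1 ≠ 0 ∨ p.2 ≠ 0) (K : ℝ) :
    ∃ M : ℝ, K < M ∧ ∀ p ∈ s, p.1 * M + p.2 ≠ 0 := by
  refine ⟨|K| + 1 + ∑ p ∈ s, |p.2 / p.1|, ?_, ?_⟩
  · have h1 : K ≤ |K| := le_abs_self K
    have h2 : 0 ≤ ∑ p ∈ s, |p.2 / p.1| := Finset.sum_nonneg fun p _ => abs_nonneg _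
    linarith
  · intro p hp
    rcases eq_or_ne p.1 0 with h0 | h0
    · rcases hs p hp with h | h
      · exact absurd h0 h
      · rw [h0, zero_mul, zero_add]; exact h
    · have hle : |p.2 / p.1| ≤ ∑ p ∈ s, |p.2 / p.1| :=
        Finset.single_le_sum (f := fun p : ℝ × ℝ => |p.2 / p.1|) (fun p _ => abs_nonneg _) hp
      have hK : 0 ≤ |K| := abs_nonneg K
      have hge : -|p.2 / p.1| ≤ p.2 / p.1 := neg_abs_le _
      have hpos : 0 < |K| + 1 + ∑ p ∈ s, |p.2 / p.1| + p.2 / p.1 := by linarith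
      have heq : p.1 * (|K| + 1 + ∑ p ∈ s, |p.2 / p.1|) + p.2 =
          p.1 * (|K| + 1 + ∑ p ∈ s, |p.2 / p.1| + p.2 / p.1) := by
        field_simp
      rw [heq]
      exact mul_ne_zero h0 hpos.ne'

/-- ★ GENERICITY WITH SIGNS: finitely many test points, each seen by some test functional, are simultaneously separated by a
combination with ALL COEFFICIENTS POSITIVE (so the combination stays inside an open orthant = the relative interior of a normal cone). -/
theorem exists_generic_comb_pos {K E : Type} [Fintype K] [DecidableEq K] (T : Finset E) (ψ : K → E → ℝ) :
    ∃ ε : K → ℝ, (∀ t, 0 < ε t) ∧ ∀ Δ ∈ T, (∃ t, ψ t Δ ≠ 0) → ∑ t, ε t * ψ t Δ ≠ 0 := by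
  classical
  suffices h : ∀ s : Finset K, ∃ ε : K → ℝ, (∀ t ∉ s, ε t = 0) ∧ (∀ t ∈ s, 0 < ε t) ∧
      ∀ Δ ∈ T, (∃ t ∈ s, ψ t Δ ≠ 0) → ∑ t, ε t * ψ t Δ ≠ 0 by
    obtain ⟨ε, -, hpos, hε⟩ := h Finset.univ
    exact ⟨ε, fun t => hpos t (Finset.mem_univ t), fun Δ hΔ ⟨t, ht⟩ => hε Δ hΔ ⟨t, Finset.mem_univ t, ht⟩⟩
  intro s
  induction s using Finset.induction_on with
  | empty =>
    exact ⟨0, fun _ _ => rfl, fun t ht => absurd ht (by simp), fun Δ _ ⟨t, ht, _⟩ => absurd ht (by simp)⟩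
  | insert a s ha ih =>
    obtain ⟨ε', hsupp, hpos, hsep⟩ := ih
    let pr : E → ℝ × ℝ := fun Δ => (ψ a Δ, ∑ t, ε' t * ψ t Δ)
    obtain ⟨τ, hτpos, hτ⟩ := exists_large_avoid ((T.image pr).filter fun p => p.1 ≠ 0 ∨ p.2 ≠ 0)
      (fun p hp => (Finset.mem_filter.1 hp).2) 0
    refine ⟨fun t => ε' t + (if t = a then τ else 0), ?_, ?_, ?_⟩
    · intro t ht
      rw [Finset.mem_insert, not_or] at ht
      show ε' t + (if t = a then τ else 0) = 0
      rw [hsupp t ht.2, if_neg ht.1, add_zero]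
    · intro t ht
      show 0 < ε' t + (if t = a then τ else 0)
      rw [Finset.mem_insert] at ht
      by_cases hta : t = a
      · rw [if_pos hta, hta, hsupp a ha, zero_add]
        exact hτpos
      · rw [if_neg hta, add_zero]
        exact hpos t (ht.resolve_left hta)
    · intro Δ hΔ hex
      have hsum : ∑ t, (ε' t + (if t = a then τ else 0)) * ψ t Δ =
          (∑ t, ε' t * ψ t Δ) + τ * ψ a Δ := by
        simp only [add_mul, Finset.sum_add_distrib, ite_mul, zero_mul, Finset.sum_ite_eq',
          Finset.mem_univ, if_true]
      rw [hsum]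
      by_cases hpair : ψ a Δ ≠ 0 ∨ ∑ t, ε' t * ψ t Δ ≠ 0
      · have hmem : pr Δ ∈ (T.image pr).filter fun p => p.1 ≠ 0 ∨ p.2 ≠ 0 :=
          Finset.mem_filter.2 ⟨Finset.mem_image_of_mem pr hΔ, hpair⟩
        have hne := hτ (pr Δ) hmem
        intro h0
        apply hne
        show ψ a Δ * τ + ∑ t, ε' t * ψ t Δ = 0
        linarith
      · rw [not_or, not_not, not_not] at hpair
        obtain ⟨t, ht, hne⟩ := hex
        rw [Finset.mem_insert] at ht
        rcases ht with rfl | ht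
        · exact absurd hpair.1 hne
        · exact absurd hpair.2 (hsep Δ hΔ ⟨t, ht, hne⟩)

/-! ### §7b the generic functional `C_ε = Σ_t ε_t ψ_t` of the normal cone of `F_0` -/

/-- test functionals of the switched face `F_0`: `ψ_0(x) = x_00`, `ψ_t(x) = x_0t − x_tt` (`t ≠ 0`).  `x` is `F_0`-ALIGNED iff all vanish. -/
def psi (n : ℕ) (t : Fin (n + 1)) (x : Fin (n + 1) × Fin (n + 1) → ℝ) : ℝ :=
  if t = 0 then x (0, 0) else x (0, t) - x (t, t)

theorem psi_neg (t : Fin (n + 1)) (x : Fin (n + 1) × Fin (n + 1) → ℝ) : psi n t (-x) = -psi n t x := by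
  unfold psi
  split_ifs
  · rfl
  · simp only [Pi.neg_apply]
    ring

theorem exists_genFun (ε : Fin (n + 1) → ℝ) :
    ∃ C : Fin (n + 1) × Fin (n + 1) → ℝ, ∀ x, C ⬝ᵥ x = ∑ t, ε t * psi n t x := by
  classical
  refine ⟨∑ t : Fin (n + 1), ε t • (if t = 0 then (Pi.single (0, 0) 1 : Fin (n + 1) × Fin (n + 1) → ℝ)
    else Pi.single (0, t) 1 - Pi.single (t, t) 1), fun x => ?_⟩
  rw [sum_dotProduct]
  refine Finset.sum_congr rfl fun t _ => ?_
  rw [smul_dotProduct, smul_eq_mul, psi]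
  congr 1
  split_ifs
  · rw [single_dotProduct, one_mul]
  · rw [sub_dotProduct, single_dotProduct, single_dotProduct, one_mul, one_mul]

/-- S4 — **PSD-FREENESS** of `lin F_0`: a Gram vector killed by every `ψ_t` is zero (`g_00 = |v_0|² = 0 ⇒ v_0 = 0 ⇒ g_0t = 0 ⇒ g_tt = |v_t|² = 0`). -/
theorem gram_eq_zero_of_psi {g : Fin (n + 1) × Fin (n + 1) → ℝ}
    (hg : ∃ (k : ℕ) (v : Fin (n + 1) → Fin k → ℝ), ∀ p q, g (p, q) = ∑ i, v p i * v q i)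
    (h : ∀ t, psi n t g = 0) : g = 0 := by
  obtain ⟨k, v, hv⟩ := hg
  have h00 : g (0, 0) = 0 := by have := h 0; unfold psi at this; rwa [if_pos rfl] at this
  have hv0 : ∀ i, v 0 i = 0 := by
    have hs : ∑ i, v 0 i * v 0 i = 0 := by rw [← hv 0 0]; exact h00
    intro i
    exact mul_self_eq_zero.1
      ((Finset.sum_eq_zero_iff_of_nonneg fun i _ => mul_self_nonneg (v 0 i)).1 hs i (Finset.mem_univ i))
  have hvt : ∀ t i, v t i = 0 := by
    intro t
    by_cases ht : t = 0
    · rw [ht]; exact hv0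
    · have h1 := h t
      unfold psi at h1
      rw [if_neg ht, hv, hv] at h1
      have h0t : ∑ i, v 0 i * v t i = 0 := Finset.sum_eq_zero fun i _ => by rw [hv0 i, zero_mul]
      rw [h0t, zero_sub, neg_eq_zero] at h1
      intro i
      exact mul_self_eq_zero.1
        ((Finset.sum_eq_zero_iff_of_nonneg fun i _ => mul_self_nonneg (v t i)).1 h1 i (Finset.mem_univ i))
  funext pq
  obtain ⟨p, q⟩ := pq
  show g (p, q) = 0
  rw [hv]
  exact Finset.sum_eq_zero fun i _ => by rw [hvt p i, zero_mul]

section GenFun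

variable {ε : Fin (n + 1) → ℝ} {C : Fin (n + 1) × Fin (n + 1) → ℝ} (hCε : ∀ x, C ⬝ᵥ x = ∑ t, ε t * psi n t x)
include hCε

/-- value of `C_ε` on the vertices of `COR(K_{n+1})`: `ε_0` on `F_0`, `−Σ_{t ≠ 0, b t} ε_t` off it. -/
theorem gen_dot_corVec (b : Fin (n + 1) → Bool) :
    C ⬝ᵥ corVec (⊤ : SimpleGraph (Fin (n + 1))) b =
      if b 0 = true then ε 0 else -(∑ t, if t ≠ 0 then (if b t = true then ε t else 0) else 0) := by
  rw [hCε]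
  cases hb0 : b 0 with
  | false =>
    rw [if_neg Bool.false_ne_true, ← Finset.sum_neg_distrib]
    refine Finset.sum_congr rfl fun t _ => ?_
    unfold psi
    by_cases ht : t = 0
    · rw [if_pos ht, if_neg (not_not.mpr ht), corVec_top_apply, neg_zero]
      simp [hb0]
    · rw [if_neg ht, if_pos ht, corVec_top_apply, corVec_top_apply]
      cases b t <;> simp [hb0]
  | true =>
    rw [if_pos rfl]
    have h0 : ε 0 * psi n 0 (corVec (⊤ : SimpleGraph (Fin (n + 1))) b) = ε 0 := by
      unfold psi; rw [if_pos rfl, corVec_top_apply]; simp [hb0]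
    rw [← Finset.add_sum_erase _ _ (Finset.mem_univ (0 : Fin (n + 1))), h0]
    suffices hs : ∑ t ∈ Finset.univ.erase (0 : Fin (n + 1)), ε t * psi n t (corVec (⊤ : SimpleGraph (Fin (n + 1))) b) = 0 by
      rw [hs, add_zero]
    refine Finset.sum_eq_zero fun t ht => ?_
    have ht0 : t ≠ 0 := Finset.ne_of_mem_erase ht
    unfold psi
    rw [if_neg ht0, corVec_top_apply, corVec_top_apply]
    cases b t <;> simp [hb0]

/-- validity (`ε > 0`). -/
theorem gen_dot_corVec_le (hε : ∀ t, 0 < ε t) (b : Fin (n + 1) → Bool) :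
    C ⬝ᵥ corVec (⊤ : SimpleGraph (Fin (n + 1))) b ≤ ε 0 := by
  rw [gen_dot_corVec hCε]
  split_ifs
  · exact le_rfl
  · have h1 : 0 ≤ ∑ t : Fin (n + 1), (if t ≠ 0 then (if b t = true then ε t else 0) else 0) :=
      Finset.sum_nonneg fun t _ => by split_ifs <;> first | exact (hε t).le | exact le_rfl
    linarith [hε 0]

/-- tight EXACTLY on `F_0`. -/
theorem gen_dot_corVec_eq_iff (hε : ∀ t, 0 < ε t) (b : Fin (n + 1) → Bool) :
    C ⬝ᵥ corVec (⊤ : SimpleGraph (Fin (n + 1))) b = ε 0 ↔ b 0 = true := by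
  rw [gen_dot_corVec hCε]
  constructor
  · intro h
    by_contra hb
    rw [if_neg hb] at h
    have h1 : 0 ≤ ∑ t : Fin (n + 1), (if t ≠ 0 then (if b t = true then ε t else 0) else 0) :=
      Finset.sum_nonneg fun t _ => by split_ifs <;> first | exact (hε t).le | exact le_rfl
    linarith [hε 0]
  · intro hb
    rw [if_pos hb]

end GenFun

/-! ### §7c the `C`-face of a zonotope all of whose nonzero generators are seen by `C` is ONE vertex -/

/-- sign vertices of the zonotope `Σ_g [−1,1]·gen g`. -/
def zvtx {G : ℕ} {m : ℕ} (gen : Fin G → (Fin m × Fin m → ℝ)) (e : Fin G → Bool) : Fin m × Fin m → ℝ :=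
  ∑ g, (if e g then (1 : ℝ) else -1) • gen g

/-- the maximising sign pattern. -/
def zsgn {G : ℕ} {m : ℕ} (C : Fin m × Fin m → ℝ) (gen : Fin G → (Fin m × Fin m → ℝ)) : Fin G → Bool :=
  fun g => decide (0 ≤ C ⬝ᵥ gen g)

theorem dot_zvtx {G m : ℕ} (C : Fin m × Fin m → ℝ) (gen : Fin G → (Fin m × Fin m → ℝ)) (e : Fin G → Bool) :
    C ⬝ᵥ zvtx gen e = ∑ g, (if e g then (1 : ℝ) else -1) * (C ⬝ᵥ gen g) := by
  unfold zvtx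
  rw [dotProduct_sum]
  refine Finset.sum_congr rfl fun g _ => ?_
  rw [dotProduct_smul, smul_eq_mul]

/-- uniqueness of the maximiser AS A POINT (free signs occur only at generators `C` does not see, i.e. at zero generators). -/
theorem zvtx_unique {G m : ℕ} (C : Fin m × Fin m → ℝ) (gen : Fin G → (Fin m × Fin m → ℝ))
    (hnz : ∀ g, gen g ≠ 0 → C ⬝ᵥ gen g ≠ 0) (e : Fin G → Bool) :
    C ⬝ᵥ zvtx gen e < C ⬝ᵥ zvtx gen (zsgn C gen) ∨ zvtx gen e = zvtx gen (zsgn C gen) := by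
  have hle_t : ∀ g, (if e g = true then (1 : ℝ) else -1) * (C ⬝ᵥ gen g) ≤ |C ⬝ᵥ gen g| :=
    fun g => sign_mul_le _ _
  have hmax : C ⬝ᵥ zvtx gen (zsgn C gen) = ∑ g, |C ⬝ᵥ gen g| := by
    rw [dot_zvtx]
    exact Finset.sum_congr rfl fun g _ => dsign_mul _
  have hle : C ⬝ᵥ zvtx gen e ≤ ∑ g, |C ⬝ᵥ gen g| := by
    rw [dot_zvtx]; exact Finset.sum_le_sum fun g _ => hle_t g
  rcases lt_or_eq_of_le hle with hlt | heq
  · left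
    rwa [hmax]
  · right
    have hterm := (Finset.sum_eq_sum_iff_of_le fun g (_ : g ∈ Finset.univ) => hle_t g).1
      (by rw [dot_zvtx] at heq; exact heq)
    unfold zvtx
    refine Finset.sum_congr rfl fun g _ => ?_
    have hg := hterm g (Finset.mem_univ g)
    by_cases hw : C ⬝ᵥ gen g = 0
    · have h0 : gen g = 0 := by
        by_contra hne
        exact hnz g hne hw
      rw [h0, smul_zero, smul_zero]
    · have hs := dsign_mul (C ⬝ᵥ gen g)
      have key : (if e g = true then (1 : ℝ) else -1) = (if zsgn C gen g = true then 1 else -1) := by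
        unfold zsgn
        exact mul_right_cancel₀ hw (hg.trans hs.symm)
      rw [key]

/-! ### §7d assembly (same text as `SwitchFace.zonotopeOf` / `IsGram` / `PSDZonotopeRung`) -/

/-- a ZONOTOPE with generator list `gen`: `Σ_i [−1,1]·gen i` (as the hull of its sign vertices). -/
def zonotopeOf {ι : Type} (G : ℕ) (gen : Fin G → (ι → ℝ)) : Set (ι → ℝ) :=
  convexHull ℝ (Set.range fun ε : Fin G → Bool => ∑ g, (if ε g then (1 : ℝ) else -1) • gen g)

/-- Gram / positive-semidefinite vectors `g_pq = ⟨v_p, v_q⟩`. -/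
def IsGram {n : ℕ} (g : Fin n × Fin n → ℝ) : Prop :=
  ∃ (k : ℕ) (v : Fin n → Fin k → ℝ), ∀ p q, g (p, q) = ∑ i, v p i * v q i

/-- ★★ **PSD-ZONOTOPE RUNG** (verbatim `SwitchFace.PSDZonotopeRung`): every zonotope whose generators are each positive OR negative
semidefinite satisfies `xc(COR(K_{n+1}) + Z) ≥ xc(COR(K_n))`. -/
def PSDZonotopeRung : Prop :=
  ∀ (n G : ℕ) (gen : Fin G → (Fin (n + 1) × Fin (n + 1) → ℝ)) (r : ℕ),
    (∀ g, IsGram (gen g) ∨ IsGram (-gen g)) →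
      HasEFOfSize (corPolytopeGraph (⊤ : SimpleGraph (Fin (n + 1))) + zonotopeOf G gen) r →
        HasEFOfSize (corPolytopeGraph (⊤ : SimpleGraph (Fin n))) r

/-- ★★ **THE PSD-ZONOTOPE RUNG HOLDS** (real rank-one towers `Σ [−1,1] v_i v_iᵀ`, Gram zonotopes, any zone count — unbudgeted). -/
theorem psdZonotopeRung_holds : PSDZonotopeRung := by
  classical
  intro n G gen r hgram h
  obtain ⟨ε, hε, hsep⟩ := exists_generic_comb_pos (K := Fin (n + 1)) (Finset.univ.image gen) (psi n)
  obtain ⟨C, hCε⟩ := exists_genFun (n := n) ε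
  have hnz : ∀ g, gen g ≠ 0 → C ⬝ᵥ gen g ≠ 0 := by
    intro g hg
    rw [hCε]
    refine hsep (gen g) (Finset.mem_image_of_mem gen (Finset.mem_univ g)) ?_
    by_contra hall
    have hall' : ∀ t, psi n t (gen g) = 0 := fun t => not_not.mp (not_exists.mp hall t)
    rcases hgram g with hG | hG
    · exact hg (gram_eq_zero_of_psi hG hall')
    · have hneg : -gen g = 0 :=
        gram_eq_zero_of_psi hG fun t => by rw [psi_neg, hall' t, neg_zero]
      exact hg (neg_eq_zero.mp hneg)
  exact located_point_rung 0 C (ε 0) (gen_dot_corVec_le hCε hε) (gen_dot_corVec_eq_iff hCε hε) (zvtx gen) (zsgn C gen)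
    (zvtx_unique C gen hnz) r h

/-- COROLLARY: `xc(COR(K_{n+1}) + Z) = r` for a `±`PSD-generated zonotope `Z` ⇒ `3^n ≤ (r+1)·2^n`. -/
theorem psdZonotope_three_pow_le (n G : ℕ) (gen : Fin G → (Fin (n + 1) × Fin (n + 1) → ℝ)) (r : ℕ)
    (hgram : ∀ g, IsGram (gen g) ∨ IsGram (-gen g))
    (h : HasEFOfSize (corPolytopeGraph (⊤ : SimpleGraph (Fin (n + 1))) + zonotopeOf G gen) r) :
    3 ^ n ≤ (r + 1) * 2 ^ n :=
  Literature.Barriers.PneNP.corPolytopeGraph_top_three_pow_le (psdZonotopeRung_holds n G gen r hgram h)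

/-! ## §8 The TOLERANT form: the located READ at `F_a` for a fibre of ANY size (composable with PROP A / class D downstream) -/

/-- ★★ **THE LOCATED READ** (tolerant engine): for `C` valid on `COR(K_{n+1})` and tight exactly on `F_a`, an EF of
`COR(K_{n+1}) + conv{q j}` of size `r` yields an EF of size `r` of `COR(K_n) + conv{read(q j − q j₀) : j a C-maximiser}` —
the passenger is replaced by the deletion read of its `C`-fibre.  (`located_point_rung` is the case of a one-point fibre.) -/
theorem located_face_read {J : Type} (a : Fin (n + 1)) (C : Fin (n + 1) × Fin (n + 1) → ℝ) (M : ℝ)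
    (valid : ∀ b : Fin (n + 1) → Bool, C ⬝ᵥ corVec (⊤ : SimpleGraph (Fin (n + 1))) b ≤ M)
    (tight : ∀ b : Fin (n + 1) → Bool, C ⬝ᵥ corVec (⊤ : SimpleGraph (Fin (n + 1))) b = M ↔ b a = true)
    (q : J → (Fin (n + 1) × Fin (n + 1) → ℝ)) (j₀ : J) (hmax : ∀ j, C ⬝ᵥ q j ≤ C ⬝ᵥ q j₀) (r : ℕ)
    (h : HasEFOfSize (corPolytopeGraph (⊤ : SimpleGraph (Fin (n + 1))) + convexHull ℝ (Set.range q)) r) :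
    HasEFOfSize (corPolytopeGraph (⊤ : SimpleGraph (Fin n)) +
      convexHull ℝ (Set.range fun j : {j : J // C ⬝ᵥ q j = C ⬝ᵥ q j₀} => delRead n a (q j.1 - q j₀))) r := by
  have hP : ∀ x ∈ corPolytopeGraph (⊤ : SimpleGraph (Fin (n + 1))), C ⬝ᵥ x ≤ M :=
    dot_le_of_mem_convexHull _ _ _ (by rintro _ ⟨b, rfl⟩; exact valid b)
  have hQ : ∀ y ∈ convexHull ℝ (Set.range q), C ⬝ᵥ y ≤ C ⬝ᵥ q j₀ :=
    dot_le_of_mem_convexHull _ _ _ (by rintro _ ⟨j, rfl⟩; exact hmax j)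
  -- the located face of the sum: `F_a + conv(fibre)`
  have h1 := h.face_add_face₁ C M (C ⬝ᵥ q j₀) hP hQ
  rw [convexHull_range_inter_eq q C _ hmax, cor_face_eq' valid] at h1
  -- translate the fibre back by `−q j₀`
  have h2 := h1.image_add_const (-q j₀)
  rw [← Set.add_singleton, add_assoc, ← convexHull_singleton (𝕜 := ℝ), ← convexHull_add, Set.add_singleton,
    ← Set.range_comp] at h2
  -- read through the deletion map (linear: sum ↦ sum, hull ↦ hull)
  have h3 := h2.image_linearMap (delRead n a)
  rw [Set.image_add, delRead_face a tight, LinearMap.image_convexHull, ← Set.range_comp] at h3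
  have hfun : (⇑(delRead n a) ∘ ((fun x => x + -q j₀) ∘ fun j : {j : J // C ⬝ᵥ q j = C ⬝ᵥ q j₀} => q j.1)) =
      fun j : {j : J // C ⬝ᵥ q j = C ⬝ᵥ q j₀} => delRead n a (q j.1 - q j₀) := by
    funext j
    simp only [Function.comp_apply, sub_eq_add_neg]
  rwa [hfun] at h3

/-- ★ COROLLARY (tolerant `SwitchExposed`, composed with PROP A ✓ `corPolytopeGraph_top_add_hull_three_pow_le`): if the `C`-fibre of the
passenger is spanned by `K` maximising generators then `3^n ≤ K·(r+1)·2^n` — e.g. a tower plus `k` extra `F_a`-aligned zones is decided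
while `k = o(n)`. -/
theorem switchExposedFibre_three_pow_le {J : Type} [Fintype J] (a : Fin (n + 1)) (C : Fin (n + 1) × Fin (n + 1) → ℝ) (M : ℝ)
    (valid : ∀ b : Fin (n + 1) → Bool, C ⬝ᵥ corVec (⊤ : SimpleGraph (Fin (n + 1))) b ≤ M)
    (tight : ∀ b : Fin (n + 1) → Bool, C ⬝ᵥ corVec (⊤ : SimpleGraph (Fin (n + 1))) b = M ↔ b a = true)
    (q : J → (Fin (n + 1) × Fin (n + 1) → ℝ)) (j₀ : J) (hmax : ∀ j, C ⬝ᵥ q j ≤ C ⬝ᵥ q j₀) (r : ℕ)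
    (h : HasEFOfSize (corPolytopeGraph (⊤ : SimpleGraph (Fin (n + 1))) + convexHull ℝ (Set.range q)) r) :
    3 ^ n ≤ Nat.card {j : J // C ⬝ᵥ q j = C ⬝ᵥ q j₀} * (r + 1) * 2 ^ n := by
  classical
  have h1 := located_face_read a C M valid tight q j₀ hmax r h
  set T := {j : J // C ⬝ᵥ q j = C ⬝ᵥ q j₀} with hT
  let e : T ≃ Fin (Fintype.card T) := Fintype.equivFin T
  have hK : 0 < Fintype.card T := Fintype.card_pos_iff.mpr ⟨⟨j₀, rfl⟩⟩
  have hrange : Set.range (fun j : T => delRead n a (q j.1 - q j₀)) =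
      Set.range ((fun j : T => delRead n a (q j.1 - q j₀)) ∘ e.symm) :=
    (e.symm.surjective.range_comp _).symm
  rw [hrange] at h1
  rw [Nat.card_eq_fintype_card]
  exact corPolytopeGraph_top_add_hull_three_pow_le _ hK h1

/-! ## §9 The (half-)MOVE-STABLE form (P-P2c): the read fibre is a DILATE of `COR(K_n)` — `COR + λ·COR + v` is as hard as `COR` -/

/-- self-similar passengers cost nothing: `xc(COR(K_m) + (λ·COR(K_m) + v)) = xc(COR(K_m))` for `λ ≥ 0` (convexity: `COR + λ·COR =
(1+λ)·COR`, then un-translate and un-scale). -/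
theorem hasEF_cor_of_selfSimilar {m : ℕ} (lam : ℝ) (hlam : 0 ≤ lam) (v : Fin m × Fin m → ℝ) (r : ℕ)
    (h : HasEFOfSize (corPolytopeGraph (⊤ : SimpleGraph (Fin m)) +
      (lam • corPolytopeGraph (⊤ : SimpleGraph (Fin m)) + {v})) r) :
    HasEFOfSize (corPolytopeGraph (⊤ : SimpleGraph (Fin m))) r := by
  have hconv : Convex ℝ (corPolytopeGraph (⊤ : SimpleGraph (Fin m))) := by
    unfold corPolytopeGraph; exact convex_convexHull ℝ _
  have hsum : corPolytopeGraph (⊤ : SimpleGraph (Fin m)) + (lam • corPolytopeGraph (⊤ : SimpleGraph (Fin m)) + {v}) =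
      (1 + lam) • corPolytopeGraph (⊤ : SimpleGraph (Fin m)) + {v} := by
    rw [← add_assoc, hconv.add_smul zero_le_one hlam, one_smul]
  rw [hsum, Set.add_singleton] at h
  have h2 := h.image_add_const (-v)
  rw [Set.image_image] at h2
  simp only [add_neg_cancel_right, Set.image_id'] at h2
  have h3 := h2.image_linearMap ((1 + lam)⁻¹ • LinearMap.id)
  have hne : (1 + lam) ≠ 0 := by positivity
  have himg : ⇑((1 + lam)⁻¹ • (LinearMap.id : (Fin m × Fin m → ℝ) →ₗ[ℝ] (Fin m × Fin m → ℝ))) ''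
      ((1 + lam) • corPolytopeGraph (⊤ : SimpleGraph (Fin m))) = corPolytopeGraph (⊤ : SimpleGraph (Fin m)) := by
    have hco : ⇑((1 + lam)⁻¹ • (LinearMap.id : (Fin m × Fin m → ℝ) →ₗ[ℝ] (Fin m × Fin m → ℝ))) =
        fun x => (1 + lam)⁻¹ • x := by
      funext x; simp
    rw [hco, Set.image_smul, smul_smul, inv_mul_cancel₀ hne, one_smul]
  rwa [himg] at h3

/-- ★ **SELF-SIMILAR LOCATED RUNG** (the R-level datum «the `C`-face of `R = COR + Q` reads as a dilate-translate of `COR(K_n)`»): if the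
deletion read of the `C`-fibre of the passenger is `λ·COR(K_n) + v`, `λ ≥ 0`, the instance is as hard as `COR(K_n)`.  This is the form that
survives val-idea-40's COR-absorbing normal-form move (which turns a one-point fibre into a translate of `F_a`, i.e. `λ = 1` after the read). -/
theorem switchLocated_selfSimilar_rung {J : Type} (a : Fin (n + 1)) (C : Fin (n + 1) × Fin (n + 1) → ℝ) (M : ℝ)
    (valid : ∀ b : Fin (n + 1) → Bool, C ⬝ᵥ corVec (⊤ : SimpleGraph (Fin (n + 1))) b ≤ M)
    (tight : ∀ b : Fin (n + 1) → Bool, C ⬝ᵥ corVec (⊤ : SimpleGraph (Fin (n + 1))) b = M ↔ b a = true)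
    (q : J → (Fin (n + 1) × Fin (n + 1) → ℝ)) (j₀ : J) (hmax : ∀ j, C ⬝ᵥ q j ≤ C ⬝ᵥ q j₀)
    (lam : ℝ) (hlam : 0 ≤ lam) (v : Fin n × Fin n → ℝ)
    (hfib : convexHull ℝ (Set.range fun j : {j : J // C ⬝ᵥ q j = C ⬝ᵥ q j₀} => delRead n a (q j.1 - q j₀)) =
      lam • corPolytopeGraph (⊤ : SimpleGraph (Fin n)) + {v}) (r : ℕ)
    (h : HasEFOfSize (corPolytopeGraph (⊤ : SimpleGraph (Fin (n + 1))) + convexHull ℝ (Set.range q)) r) :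
    HasEFOfSize (corPolytopeGraph (⊤ : SimpleGraph (Fin n))) r := by
  have h1 := located_face_read a C M valid tight q j₀ hmax r h
  rw [hfib] at h1
  exact hasEF_cor_of_selfSimilar lam hlam v r h1

end Summit.ValiantsHypothesis.ValiantsHypothesis.Cruxes.NNDivisionHard.SwitchFace

end
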